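import Literature.Analysis.Complex.SeveralVariables
import Mathlib.Topology.Homotopy.Lifting
import Mathlib.AlgebraicTopology.FundamentalGroupoid.SimplyConnected
import Mathlib.Analysis.Complex.Polynomial.Basic
import Mathlib.FieldTheory.Separable
import Mathlib.Topology.Algebra.Module.LocallyConvex
import HarnessLib

/-!
# Holomorphic roots of a monic polynomial with holomorphic coefficients: local root systems and
# global roots over simply connected bases

Topic `Literature/Analysis/Complex` (namespace `Literature.Analysis.Complex.RootCover`). For the
monic family `P_x(Z) = Zⁿ + Σ_{k<n} aₖ(x) Zᵏ` whose coefficients `aₖ : B → ℂ` are holomorphic on an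
open set `U` of a finite-dimensional complex normed space `B`:

* `exists_local_root` — a SIMPLE root `z₀` of `P_{x₀}` moves holomorphically: near `x₀` there is a
  holomorphic `r` with `r x₀ = z₀`, `P_x(r x) = 0`, and `r x` is the only root of `P_x` near `z₀`
  (holomorphic implicit function theorem, `Literature.Analysis.Complex.SCV.exists_straightening`);
* `exists_local_root_system` — if `P_{x₀}` is separable then near `x₀` all roots are given by `n`
  holomorphic, pointwise distinct functions: `P_x = ∏ₗ (Z − rₗ x)`;
* `exists_global_roots` — **if `P_x` is separable for every `x` in an open, simply connected `U`,
  then there are holomorphic `g₁, …, gₙ : U → ℂ` with `P_x = ∏ₗ (Z − gₗ x)` on `U`**: the root set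
  `{(x, z) | P_x(z) = 0}` is a covering space of `U` (local root systems are local trivialisations)
  and a covering of a simply connected, locally path connected space has a continuous section through
  every point of a fibre (Mathlib's `IsCoveringMap.existsUnique_continuousMap_lifts`); continuous
  roots are holomorphic because locally they coincide with one of the `rₗ`.

This is the topological half of Jung's proof of the Abhyankar–Jung theorem (Parusiński–Rond,
Prop. 2.1: over the complement of the discriminant the roots form a finite covering, trivial over a
simply connected base). Everything is proved; no definitions (the family is written out in every
statement), no named facts.

## References

* A. Parusiński, G. Rond, *The Abhyankar–Jung theorem*, J. Algebra 365 (2012) 29–41, Prop. 2.1.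
* O. Forster, *Lectures on Riemann Surfaces*, GTM 81 (1981), §8 (algebraic functions as coverings).
-/

noncomputable section

open Complex Metric Set Filter Polynomial Topology

namespace Literature.Analysis.Complex
namespace RootCover

section Algebra

variable {B : Type*}

/-! ### The family `P_x = Zⁿ + Σ aₖ(x) Zᵏ` (algebra) -/

/-- Evaluation of the family `Zⁿ + Σ_{k<n} aₖ(x) Zᵏ` at `z`. [folklore] -/
theorem eval_family {n : ℕ} (a : Fin n → B → ℂ) (x : B) (z : ℂ) :
    (X ^ n + ∑ k : Fin n, C (a k x) * X ^ (k : ℕ)).eval z = z ^ n + ∑ k : Fin n, a k x * z ^ (k : ℕ) := by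
  simp [eval_finsetSum]

/-- The lower part `Σ_{k<n} aₖ(x) Zᵏ` has degree `< n`. [folklore] -/
theorem degree_lower_lt {n : ℕ} (a : Fin n → B → ℂ) (x : B) :
    (∑ k : Fin n, C (a k x) * X ^ (k : ℕ)).degree < (n : WithBot ℕ) := by
  refine (degree_sum_le _ _).trans_lt ?_
  refine (Finset.sup_lt_iff (WithBot.bot_lt_coe n)).2 fun k _ => ?_
  exact (degree_C_mul_X_pow_le (k : ℕ) (a k x)).trans_lt (WithBot.coe_lt_coe.2 k.2)

/-- The family is monic. [folklore] -/
theorem monic_family {n : ℕ} (a : Fin n → B → ℂ) (x : B) :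
    (X ^ n + ∑ k : Fin n, C (a k x) * X ^ (k : ℕ)).Monic :=
  monic_X_pow_add (degree_lower_lt a x)

/-- The family has degree `n`. [folklore] -/
theorem natDegree_family {n : ℕ} (a : Fin n → B → ℂ) (x : B) :
    (X ^ n + ∑ k : Fin n, C (a k x) * X ^ (k : ℕ)).natDegree = n := by
  rw [natDegree_add_eq_left_of_degree_lt, natDegree_X_pow]
  rw [degree_X_pow]
  exact degree_lower_lt a x

/-- Over `ℂ` a separable member of the family is the product of `Z − root` over its `n` distinct
roots, enumerated by `Fin n`. [folklore] -/
theorem exists_enum_roots {n : ℕ} (a : Fin n → B → ℂ) (x : B)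
    (hsep : (X ^ n + ∑ k : Fin n, C (a k x) * X ^ (k : ℕ)).Separable) :
    ∃ z : Fin n → ℂ, Function.Injective z ∧
      (X ^ n + ∑ k : Fin n, C (a k x) * X ^ (k : ℕ)) = ∏ l, (X - C (z l)) := by
  set p : ℂ[X] := X ^ n + ∑ k : Fin n, C (a k x) * X ^ (k : ℕ) with hp
  have hmon : p.Monic := monic_family a x
  have hcard : Multiset.card p.roots = p.natDegree :=
    splits_iff_card_roots.1 (IsAlgClosed.splits p)
  have hnd : p.roots.Nodup := nodup_roots hsep
  have hdeg : p.natDegree = n := natDegree_family a x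
  -- enumerate the roots
  set s : Finset ℂ := p.roots.toFinset with hs
  have hsval : s.val = p.roots := Multiset.toFinset_val _ |>.trans (Multiset.dedup_eq_self.2 hnd)
  have hscard : s.card = n := by
    rw [← hdeg, ← hcard, ← hsval]; rfl
  let e : Fin n ≃ s := (Fintype.equivFinOfCardEq (by simpa using hscard)).symm
  refine ⟨fun l => (e l : ℂ), fun l l' h => e.injective (Subtype.ext h), ?_⟩
  calc p = (p.roots.map fun a => X - C a).prod :=
        (prod_multiset_X_sub_C_of_monic_of_roots_card_eq hmon hcard).symm
    _ = ∏ w ∈ s, (X - C w) := by rw [Finset.prod_eq_multiset_prod, hsval]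
    _ = ∏ w : s, (X - C (w : ℂ)) := (Finset.prod_coe_sort s _).symm
    _ = ∏ l, (X - C ((e l : s) : ℂ)) := (Fintype.prod_equiv e _ _ fun _ => rfl).symm

/-- If a monic degree-`n` member of the family has the `n` pointwise distinct values `z l` among its
roots, it is their product `∏ (Z − z l)`. [folklore] -/
theorem eq_prod_of_roots {n : ℕ} (a : Fin n → B → ℂ) (x : B) (z : Fin n → ℂ)
    (hz : Function.Injective z)
    (hroot : ∀ l, (X ^ n + ∑ k : Fin n, C (a k x) * X ^ (k : ℕ)).IsRoot (z l)) :
    (X ^ n + ∑ k : Fin n, C (a k x) * X ^ (k : ℕ)) = ∏ l, (X - C (z l)) := by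
  set p : ℂ[X] := X ^ n + ∑ k : Fin n, C (a k x) * X ^ (k : ℕ) with hp
  have hmon : p.Monic := monic_family a x
  have hdeg : p.natDegree = n := natDegree_family a x
  have hq : (∏ l, (X - C (z l))).Monic := monic_prod_of_monic _ _ fun _ _ => monic_X_sub_C _
  have hdvd : (∏ l, (X - C (z l))) ∣ p := by
    have : (∏ l, (X - C (z l))) = ((Finset.univ.image z).val.map fun w => X - C w).prod := by
      rw [← Finset.prod_eq_multiset_prod, Finset.prod_image fun l _ l' _ h => hz h]
    rw [this]
    refine (Multiset.prod_X_sub_C_dvd_iff_le_roots hmon.ne_zero _).2 ?_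
    rw [Finset.image_val, Multiset.le_iff_subset (Multiset.nodup_dedup _)]
    intro w hw
    obtain ⟨l, -, rfl⟩ := Multiset.mem_map.1 (Multiset.mem_dedup.1 hw)
    exact (mem_roots hmon.ne_zero).2 (hroot l)
  have hdegq : (∏ l, (X - C (z l))).natDegree = n := by
    rw [natDegree_prod_of_monic _ _ fun _ _ => monic_X_sub_C _]; simp
  exact eq_of_monic_of_dvd_of_natDegree_le hq hmon hdvd (by rw [hdeg, hdegq])

end Algebra

section Analysis

variable {B : Type*} [NormedAddCommGroup B] [NormedSpace ℂ B]

/-! ### Holomorphy of the evaluation map -/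

/-- `(x, z) ↦ P_x(z)` is holomorphic on `U × ℂ` when the coefficients are holomorphic on `U`. [folklore] -/
theorem differentiableOn_eval_family {n : ℕ} {a : Fin n → B → ℂ} {U : Set B}
    (ha : ∀ k, DifferentiableOn ℂ (a k) U) :
    DifferentiableOn ℂ (fun p : B × ℂ => (X ^ n + ∑ k : Fin n, C (a k p.1) * X ^ (k : ℕ)).eval p.2)
      (U ×ˢ univ) := by
  have h : (fun p : B × ℂ => (X ^ n + ∑ k : Fin n, C (a k p.1) * X ^ (k : ℕ)).eval p.2) =
      fun p : B × ℂ => p.2 ^ n + ∑ k : Fin n, a k p.1 * p.2 ^ (k : ℕ) := by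
    funext p; exact eval_family a p.1 p.2
  rw [h]
  refine DifferentiableOn.add (differentiableOn_snd.pow n) (DifferentiableOn.fun_sum fun k _ => ?_)
  exact ((ha k).comp differentiableOn_fst fun p hp => hp.1).mul (differentiableOn_snd.pow _)

omit [NormedAddCommGroup B] [NormedSpace ℂ B] in
/-- For fixed `x`, `z ↦ P_x(z)` has derivative `P_x'(z)`. [folklore] -/
theorem hasDerivAt_eval_family {n : ℕ} (a : Fin n → B → ℂ) (x : B) (z : ℂ) :
    HasDerivAt (fun t : ℂ => (X ^ n + ∑ k : Fin n, C (a k x) * X ^ (k : ℕ)).eval t)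
      ((derivative (X ^ n + ∑ k : Fin n, C (a k x) * X ^ (k : ℕ))).eval z) z :=
  Polynomial.hasDerivAt _ _

variable [FiniteDimensional ℂ B]

/-! ### A simple root moves holomorphically -/

/-- **A simple root of `P_{x₀}` moves holomorphically** (holomorphic implicit function theorem): if
`z₀` is a root of `P_{x₀}` with `P'_{x₀}(z₀) ≠ 0` and the coefficients are holomorphic on the open
set `U ∋ x₀`, then on an open `W ∋ x₀`, `W ⊆ U`, there is a holomorphic `r` with `r x₀ = z₀`,
`P_x(r x) = 0`, `r x` close to `z₀`, and `r x` is the ONLY root of `P_x` in a fixed disc around `z₀`.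
[folklore] -/
theorem exists_local_root {n : ℕ} {a : Fin n → B → ℂ} {U : Set B} (hU : IsOpen U)
    (ha : ∀ k, DifferentiableOn ℂ (a k) U) {x₀ : B} (hx₀ : x₀ ∈ U) {z₀ : ℂ}
    (hroot : (X ^ n + ∑ k : Fin n, C (a k x₀) * X ^ (k : ℕ)).IsRoot z₀)
    (hsimple : (derivative (X ^ n + ∑ k : Fin n, C (a k x₀) * X ^ (k : ℕ))).eval z₀ ≠ 0) :
    ∃ W : Set B, IsOpen W ∧ x₀ ∈ W ∧ W ⊆ U ∧ ∃ ε : ℝ, 0 < ε ∧ ∃ r : B → ℂ,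
      DifferentiableOn ℂ r W ∧ r x₀ = z₀ ∧
      (∀ x ∈ W, (X ^ n + ∑ k : Fin n, C (a k x) * X ^ (k : ℕ)).IsRoot (r x) ∧ r x ∈ ball z₀ ε) ∧
      ∀ x ∈ W, ∀ z ∈ ball z₀ ε, (X ^ n + ∑ k : Fin n, C (a k x) * X ^ (k : ℕ)).IsRoot z → z = r x := by
  -- the holomorphic map `g (x, z) = P_x(z)` on `U × ℂ`
  set g : B × ℂ → ℂ := fun p => (X ^ n + ∑ k : Fin n, C (a k p.1) * X ^ (k : ℕ)).eval p.2 with hg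
  have hgd : DifferentiableOn ℂ g (U ×ˢ univ) := differentiableOn_eval_family ha
  have hWo : IsOpen (U ×ˢ (univ : Set ℂ)) := hU.prod isOpen_univ
  have hamem : (x₀, z₀) ∈ U ×ˢ (univ : Set ℂ) := ⟨hx₀, mem_univ _⟩
  have hga : g (x₀, z₀) = 0 := hroot
  -- the derivative of `g` at `(x₀, z₀)` in the `z`-direction is `P'_{x₀}(z₀)`
  set c : ℂ := (derivative (X ^ n + ∑ k : Fin n, C (a k x₀) * X ^ (k : ℕ))).eval z₀ with hc
  set L := fderiv ℂ g (x₀, z₀) with hL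
  have hgL : HasFDerivAt g L (x₀, z₀) := (hgd.differentiableAt (hWo.mem_nhds hamem)).hasFDerivAt
  have hL0t : ∀ t : ℂ, L (0, t) = c * t := by
    intro t
    have hf : HasDerivAt (fun s : ℂ => ((x₀, z₀ + s) : B × ℂ)) (((0 : B), (1 : ℂ)) : B × ℂ) 0 :=
      (hasDerivAt_const (0 : ℂ) x₀).prodMk ((hasDerivAt_id (0 : ℂ)).const_add z₀)
    have hgL' : HasFDerivAt g L (x₀, z₀ + 0) := by rw [add_zero]; exact hgL
    have h1 : HasDerivAt (fun s : ℂ => g (x₀, z₀ + s)) (L ((0 : B), (1 : ℂ))) 0 := by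
      have h := hgL'.comp_hasDerivAt (0 : ℂ) hf
      rwa [Function.comp_def] at h
    have h7 : HasDerivAt (fun t : ℂ => (X ^ n + ∑ k : Fin n, C (a k x₀) * X ^ (k : ℕ)).eval t) c
        (z₀ + 0) := by rw [add_zero]; exact hasDerivAt_eval_family a x₀ z₀
    have h6 : HasDerivAt (fun s : ℂ => g (x₀, z₀ + s)) c 0 := h7.comp_const_add z₀ 0
    have h8 : L (0, 1) = c := h1.unique h6
    have : L (0, t) = L (t • ((0, 1) : B × ℂ)) := by simp
    rw [this, map_smul, h8, smul_eq_mul, mul_comm]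
  -- bijectivity of `(L, fst)`
  have hbij : Function.Bijective (L.prod (ContinuousLinearMap.fst ℂ B ℂ)) := by
    constructor
    · rintro ⟨v, t⟩ ⟨v', t'⟩ h
      simp only [ContinuousLinearMap.prod_apply, ContinuousLinearMap.coe_fst', Prod.mk.injEq] at h
      obtain ⟨h1, rfl⟩ := h
      have h2 : L ((v, t) - (v, t')) = 0 := by rw [map_sub, h1, sub_self]
      have h3 : ((v, t) - (v, t') : B × ℂ) = (0, t - t') := by simp
      rw [h3, hL0t] at h2
      have h4 : t - t' = 0 := (mul_eq_zero.1 h2).resolve_left hsimple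
      rw [sub_eq_zero.1 h4]
    · rintro ⟨w, v⟩
      refine ⟨(v, (w - L (v, 0)) / c), ?_⟩
      simp only [ContinuousLinearMap.prod_apply, ContinuousLinearMap.coe_fst', Prod.mk.injEq,
        and_true]
      have h1 : ((v, (w - L (v, 0)) / c) : B × ℂ) = (v, 0) + (0, (w - L (v, 0)) / c) := by simp
      rw [h1, map_add, hL0t, mul_div_cancel₀ _ hsimple]
      ring
  -- straightening
  obtain ⟨S, T, Ψ, hSo, haS, hSW, hTo, hΨd, hΦΨ, hΨΦ, -⟩ :=
    SCV.exists_straightening hgd hWo hamem (ContinuousLinearMap.fst ℂ B ℂ) hbij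
  simp only [ContinuousLinearMap.coe_fst', Prod.fst_sub] at hΦΨ hΨΦ
  -- the root function
  set W₀ : Set B := {x | ((0 : ℂ), x - x₀) ∈ T} with hW₀
  have hW₀o : IsOpen W₀ := hTo.preimage (by fun_prop)
  have hx₀W₀ : x₀ ∈ W₀ := by
    show ((0 : ℂ), x₀ - x₀) ∈ T
    have := (hΦΨ _ haS).1
    rw [hga] at this
    simpa using this
  set r : B → ℂ := fun x => (Ψ (0, x - x₀)).2 with hr
  have hΨeq : ∀ x ∈ W₀, Ψ (0, x - x₀) = (x, r x) := by
    intro x hx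
    have h1 := (hΨΦ _ hx).2
    have h2 : (Ψ (0, x - x₀)).1 = x := by
      have := congrArg Prod.snd h1
      simpa [sub_left_inj] using this
    exact Prod.ext h2 rfl
  have hrootr : ∀ x ∈ W₀, (X ^ n + ∑ k : Fin n, C (a k x) * X ^ (k : ℕ)).IsRoot (r x) := by
    intro x hx
    have h1 := (hΨΦ _ hx).2
    have h2 : g (Ψ (0, x - x₀)) = 0 := by
      have := congrArg Prod.fst h1
      simpa using this
    rw [hΨeq x hx] at h2
    exact h2
  have hrS : ∀ x ∈ W₀, (x, r x) ∈ S := fun x hx => hΨeq x hx ▸ (hΨΦ _ hx).1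
  have hrx₀ : r x₀ = z₀ := by
    have h1 := (hΦΨ _ haS).2
    rw [hga, sub_self] at h1
    have h2 := hΨeq x₀ hx₀W₀
    rw [sub_self] at h2
    rw [h2] at h1
    exact (congrArg Prod.snd h1)
  have hrd : DifferentiableOn ℂ r W₀ := by
    have h1 : DifferentiableOn ℂ (fun x : B => ((0 : ℂ), x - x₀)) W₀ := by fun_prop
    exact (hΨd.comp h1 fun x hx => hx).snd
  have hrc : ContinuousOn r W₀ := hrd.continuousOn
  -- a product neighbourhood inside `S`
  obtain ⟨W₁, hW₁, ε, hε, hprod⟩ : ∃ W₁ : Set B, W₁ ∈ 𝓝 x₀ ∧ ∃ ε : ℝ, 0 < ε ∧ W₁ ×ˢ ball z₀ ε ⊆ S := by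
    have hS : S ∈ 𝓝 (x₀, z₀) := hSo.mem_nhds haS
    obtain ⟨W₁, hW₁, V₁, hV₁, h⟩ := mem_nhds_prod_iff.1 hS
    obtain ⟨ε, hε, hball⟩ := Metric.mem_nhds_iff.1 hV₁
    exact ⟨W₁, hW₁, ε, hε, (prod_mono le_rfl hball).trans h⟩
  obtain ⟨W₂, hW₂W₁, hW₂o, hx₀W₂⟩ := _root_.mem_nhds_iff.1 hW₁
  set W : Set B := (W₀ ∩ r ⁻¹' ball z₀ ε) ∩ W₂ with hW
  have hWo' : IsOpen (W₀ ∩ r ⁻¹' ball z₀ ε) := hrc.isOpen_inter_preimage hW₀o isOpen_ball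
  refine ⟨W, hWo'.inter hW₂o, ⟨⟨hx₀W₀, by simp [hrx₀, hε]⟩, hx₀W₂⟩, ?_, ε, hε, r,
    hrd.mono fun x hx => hx.1.1, hrx₀, fun x hx => ⟨hrootr x hx.1.1, hx.1.2⟩, ?_⟩
  · intro x hx
    exact (hSW (hrS x hx.1.1)).1
  · intro x hx z hz hzr
    have hxz : (x, z) ∈ S := hprod ⟨hW₂W₁ hx.2, hz⟩
    have h1 := (hΦΨ _ hxz).2
    have h2 : g (x, z) = 0 := hzr
    rw [h2] at h1
    have h3 := hΨeq x hx.1.1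
    rw [h1] at h3
    exact (congrArg Prod.snd h3)

/-! ### Local holomorphic root systems -/

/-- A root of a separable polynomial is simple: the derivative does not vanish there. [folklore] -/
theorem eval_derivative_ne_zero_of_separable {p : ℂ[X]} (hsep : p.Separable) {z : ℂ}
    (hz : p.IsRoot z) : (derivative p).eval z ≠ 0 := by
  obtain ⟨u, v, h⟩ := hsep
  intro h0
  have h1 := congrArg (eval z) h
  rw [eval_add, eval_mul, eval_mul, hz.eq_zero, h0, eval_one] at h1
  simp at h1

/-- **Local holomorphic root system.** If the coefficients are holomorphic on the open `U ∋ x₀` and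
`P_{x₀}` is separable, then on an open `W ∋ x₀`, `W ⊆ U`, there are `n` holomorphic functions `rₗ`,
pairwise distinct at every point, with `P_x = ∏ₗ (Z − rₗ x)` for all `x ∈ W`. [folklore] -/
theorem exists_local_root_system {n : ℕ} {a : Fin n → B → ℂ} {U : Set B} (hU : IsOpen U)
    (ha : ∀ k, DifferentiableOn ℂ (a k) U) {x₀ : B} (hx₀ : x₀ ∈ U)
    (hsep : (X ^ n + ∑ k : Fin n, C (a k x₀) * X ^ (k : ℕ)).Separable) :
    ∃ W : Set B, IsOpen W ∧ x₀ ∈ W ∧ W ⊆ U ∧ ∃ r : Fin n → B → ℂ,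
      (∀ l, DifferentiableOn ℂ (r l) W) ∧
      (∀ x ∈ W, Function.Injective fun l => r l x) ∧
      ∀ x ∈ W, (X ^ n + ∑ k : Fin n, C (a k x) * X ^ (k : ℕ)) = ∏ l, (X - C (r l x)) := by
  obtain ⟨z, hz, hprod⟩ := exists_enum_roots a x₀ hsep
  have hzroot : ∀ l, (X ^ n + ∑ k : Fin n, C (a k x₀) * X ^ (k : ℕ)).IsRoot (z l) := by
    intro l
    rw [hprod, IsRoot.def, eval_prod]
    exact Finset.prod_eq_zero (Finset.mem_univ l) (by simp)
  have hsimple : ∀ l, (derivative (X ^ n + ∑ k : Fin n, C (a k x₀) * X ^ (k : ℕ))).eval (z l) ≠ 0 :=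
    fun l => eval_derivative_ne_zero_of_separable hsep (hzroot l)
  choose W hWo hx₀W hWU ε hε r hrd hrx₀ hrroot hruniq using
    fun l => exists_local_root hU ha hx₀ (hzroot l) (hsimple l)
  -- the neighbourhood: all `W l`, and the open sets where the `r l` stay pairwise distinct
  set D : Fin n → Fin n → Set B := fun l l' =>
    (W l ∩ W l') ∩ (fun x => r l x - r l' x) ⁻¹' ({0}ᶜ : Set ℂ) with hD
  have hDo : ∀ l l', IsOpen (D l l') := by
    intro l l'
    refine ContinuousOn.isOpen_inter_preimage ?_ ((hWo l).inter (hWo l')) isOpen_compl_singleton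
    exact ((hrd l).continuousOn.mono inter_subset_left).sub
      ((hrd l').continuousOn.mono inter_subset_right)
  set W' : Set B := U ∩ ((⋂ l, W l) ∩ ⋂ l, ⋂ l', ⋂ (_ : l ≠ l'), D l l') with hW'
  have hW'o : IsOpen W' := by
    refine hU.inter ((isOpen_iInter_of_finite hWo).inter (isOpen_iInter_of_finite fun l => ?_))
    exact isOpen_iInter_of_finite fun l' => isOpen_iInter_of_finite fun _ => hDo l l'
  have hx₀W' : x₀ ∈ W' := by
    refine ⟨hx₀, mem_iInter.2 hx₀W,
      mem_iInter.2 fun l => mem_iInter.2 fun l' => mem_iInter.2 fun hll' => ?_⟩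
    refine ⟨⟨hx₀W l, hx₀W l'⟩, ?_⟩
    show r l x₀ - r l' x₀ ∈ ({0}ᶜ : Set ℂ)
    rw [hrx₀, hrx₀, mem_compl_singleton_iff, sub_ne_zero]
    exact fun h => hll' (hz h)
  have hW'W : ∀ l, W' ⊆ W l := fun l x hx => mem_iInter.1 hx.2.1 l
  have hinj : ∀ x ∈ W', Function.Injective fun l => r l x := by
    intro x hx l l' h
    by_contra hll'
    have hxD : x ∈ D l l' := mem_iInter.1 (mem_iInter.1 (mem_iInter.1 hx.2.2 l) l') hll'
    exact hxD.2 (by simpa [sub_eq_zero] using h)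
  refine ⟨W', hW'o, hx₀W', fun x hx => hx.1, r, fun l => (hrd l).mono (hW'W l), hinj, ?_⟩
  intro x hx
  exact eq_prod_of_roots a x (fun l => r l x) (hinj x hx) fun l => (hrroot l x (hW'W l hx)).1

/-! ### The root cover over a simply connected base -/

omit [NormedSpace ℂ B] [FiniteDimensional ℂ B] in
/-- A value among finitely many pointwise distinct continuous functions which is itself continuous
follows one of them near any point: if `f y = r m₀ y`, all `r m` are continuous at `y`, `f` is
continuous at `y` within `s`, and `f x ∈ {r m x | m}` on `s`, then `f = r m₀` near `y` within `s`.
[folklore] -/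
theorem eventuallyEq_of_mem_range {ι : Type*} [Fintype ι] {f : B → ℂ} {r : ι → B → ℂ} {s : Set B}
    {y : B} {m₀ : ι} (hf : ContinuousWithinAt f s y) (hr : ∀ m, ContinuousAt (r m) y)
    (hinj : Function.Injective fun m => r m y) (hy : f y = r m₀ y)
    (hmem : ∀ x ∈ s, ∃ m, f x = r m x) : f =ᶠ[𝓝[s] y] r m₀ := by
  -- near `y` within `s`, `f` stays away from the other branches
  have hne : ∀ m, m ≠ m₀ → ∀ᶠ x in 𝓝[s] y, f x ≠ r m x := by
    intro m hm
    have h0 : f y - r m y ≠ 0 := by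
      rw [hy, sub_ne_zero]
      exact fun h => hm (hinj h).symm
    have hc : ContinuousWithinAt (fun x => f x - r m x) s y := hf.sub (hr m).continuousWithinAt
    exact (hc.eventually_ne h0).mono fun x hx h => hx (sub_eq_zero.2 h)
  have hall : ∀ᶠ x in 𝓝[s] y, ∀ m, m ≠ m₀ → f x ≠ r m x :=
    ((eventually_all_finite (Set.toFinite {m | m ≠ m₀})).2 fun m hm => hne m hm).mono
      fun x hx m hm => hx m hm
  filter_upwards [hall, self_mem_nhdsWithin] with x hx hxs
  obtain ⟨m, hm⟩ := hmem x hxs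
  by_cases hmm : m = m₀
  · rw [hm, hmm]
  · exact absurd hm (hx m hmm)

/-- **Global holomorphic roots over a simply connected base.** Let the coefficients `aₖ` be
holomorphic on an open set `U` which is simply connected (as a subspace), and suppose `P_x` is
separable for every `x ∈ U`. Then there are holomorphic `g₁, …, gₙ` on `U` with
`P_x = ∏ₗ (Z − gₗ x)` for all `x ∈ U`. Proof: the root set `{(x, z) | x ∈ U, P_x(z) = 0}` with its
projection to `U` is a covering map (the local root systems `exists_local_root_system` are local
trivialisations with fibre `Fin n`); a covering of a simply connected, locally path connected space has
a continuous section through each point of a fibre (`IsCoveringMap.existsUnique_continuousMap_lifts`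
applied to the identity of `U`); a continuous root is holomorphic since it locally follows one branch
of a local root system; sections through distinct points of a fibre never meet (uniqueness of lifts).
[Parusiński–Rond 2012, Prop. 2.1 (proof); Forster, *Riemann Surfaces*, §8] [cite: ParusinskiRond2012, Prop. 2.1] -/
theorem exists_global_roots {n : ℕ} {a : Fin n → B → ℂ} {U : Set B} (hU : IsOpen U)
    [SimplyConnectedSpace U] (ha : ∀ k, DifferentiableOn ℂ (a k) U)
    (hsep : ∀ x ∈ U, (X ^ n + ∑ k : Fin n, C (a k x) * X ^ (k : ℕ)).Separable) :
    ∃ g : Fin n → B → ℂ, (∀ l, DifferentiableOn ℂ (g l) U) ∧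
      ∀ x ∈ U, (X ^ n + ∑ k : Fin n, C (a k x) * X ^ (k : ℕ)) = ∏ l, (X - C (g l x)) := by
  classical
  -- total space of the root cover and its projection
  let E := {e : U × ℂ // (X ^ n + ∑ k : Fin n, C (a k (e.1 : B)) * X ^ (k : ℕ)).IsRoot e.2}
  let proj : E → U := fun e => e.1.1
  have hproj : Continuous proj := continuous_fst.comp continuous_subtype_val
  have hval : Continuous fun e : E => e.1.2 := continuous_snd.comp continuous_subtype_val
  -- local root systems at every point of `U`
  choose W hWo hxW hWU r hrd hrinj hrprod using
    fun x : U => exists_local_root_system hU ha x.2 (hsep x x.2)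
  have hrc : ∀ (x : U) l, ContinuousOn (r x l) (W x) := fun x l => (hrd x l).continuousOn
  -- roots over `W x` are values of the branches `r x l`
  have hmem : ∀ (x : U) (y : B), y ∈ W x → ∀ w : ℂ,
      (X ^ n + ∑ k : Fin n, C (a k y) * X ^ (k : ℕ)).IsRoot w → ∃ l, r x l y = w := by
    intro x y hy w hw
    rw [hrprod x y hy, IsRoot.def, eval_prod, Finset.prod_eq_zero_iff] at hw
    obtain ⟨l, -, hl⟩ := hw
    have : w = r x l y := by simpa [sub_eq_zero] using hl
    exact ⟨l, this.symm⟩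
  have hbranch_root : ∀ (x : U) (y : B), y ∈ W x → ∀ l,
      (X ^ n + ∑ k : Fin n, C (a k y) * X ^ (k : ℕ)).IsRoot (r x l y) := by
    intro x y hy l
    rw [hrprod x y hy, IsRoot.def, eval_prod]
    exact Finset.prod_eq_zero (Finset.mem_univ l) (by simp)
  -- the projection is a covering map
  have hcov : IsCoveringMap proj := by
    intro x
    let V : Set U := Subtype.val ⁻¹' W x
    have hVo : IsOpen V := (hWo x).preimage continuous_subtype_val
    have hxV : x ∈ V := hxW x
    -- the branch index of a point of the cover over `V`
    have hex : ∀ e : proj ⁻¹' V, ∃ l, r x l ((e : E).1.1 : B) = (e : E).1.2 := fun e =>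
      hmem x _ e.2 _ (e : E).2
    let idx : proj ⁻¹' V → Fin n := fun e => Classical.choose (hex e)
    have hidx : ∀ e : proj ⁻¹' V, r x (idx e) ((e : E).1.1 : B) = (e : E).1.2 := fun e =>
      Classical.choose_spec (hex e)
    have hidx_iff : ∀ (e : proj ⁻¹' V) l, idx e = l ↔ r x l ((e : E).1.1 : B) = (e : E).1.2 := by
      intro e l
      constructor
      · rintro rfl; exact hidx e
      · intro h; exact hrinj x _ e.2 ((hidx e).trans h.symm)
    have hcont_branch : ∀ l, Continuous fun e : proj ⁻¹' V => r x l ((e : E).1.1 : B) := fun l =>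
      (hrc x l).comp_continuous ((continuous_subtype_val.comp hproj).comp continuous_subtype_val)
        fun e => e.2
    have hidxc : Continuous idx := by
      refine continuous_discrete_rng.2 fun l => ?_
      have hset : idx ⁻¹' {l} = ⋂ m, ⋂ (_ : m ≠ l),
          {e : proj ⁻¹' V | (e : E).1.2 ≠ r x m ((e : E).1.1 : B)} := by
        ext e
        simp only [mem_preimage, mem_singleton_iff, mem_iInter, mem_setOf_eq]
        constructor
        · rintro h m hm heq
          exact hm ((hidx_iff e m).2 heq.symm ▸ h.symm).symm
        · intro h
          by_contra hl
          exact h (idx e) hl (hidx e).symm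
      rw [hset]
      refine isOpen_iInter_of_finite fun m => isOpen_iInter_of_finite fun _ => ?_
      exact isOpen_ne_fun (hval.comp continuous_subtype_val) (hcont_branch m)
    -- the trivialisation over `V`
    let H : proj ⁻¹' V ≃ₜ V × Fin n :=
      { toFun := fun e => (⟨proj e, e.2⟩, idx e)
        invFun := fun p => ⟨⟨((p.1 : U), r x p.2 (p.1 : B)), hbranch_root x _ p.1.2 p.2⟩, p.1.2⟩
        left_inv := fun e => by
          apply Subtype.ext; apply Subtype.ext
          exact Prod.ext rfl (hidx e)
        right_inv := fun p => by
          refine Prod.ext (Subtype.ext rfl) ?_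
          exact (hidx_iff _ _).2 rfl
        continuous_toFun := (hproj.comp continuous_subtype_val).subtype_mk _ |>.prodMk hidxc
        continuous_invFun := by
          refine continuous_prod_of_discrete_right.2 fun l => ?_
          refine Continuous.subtype_mk (Continuous.subtype_mk ?_ _) _
          exact continuous_subtype_val.prodMk
            ((hrc x l).comp_continuous (continuous_subtype_val.comp continuous_subtype_val)
              fun v => v.2) }
    exact IsEvenlyCovered.to_isEvenlyCovered_preimage
      ⟨inferInstance, V, hxV, hVo, hVo.preimage hproj, H, fun _ => rfl⟩
  -- sections through the roots over a base point
  haveI : LocallyPathConnectedSpace U := hU.locallyPathConnectedSpace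
  obtain ⟨x₀⟩ : Nonempty U := inferInstance
  obtain ⟨z, hz, hzprod⟩ := exists_enum_roots a (x₀ : B) (hsep x₀ x₀.2)
  have hzroot : ∀ l, (X ^ n + ∑ k : Fin n, C (a k (x₀ : B)) * X ^ (k : ℕ)).IsRoot (z l) := by
    intro l
    rw [hzprod, IsRoot.def, eval_prod]
    exact Finset.prod_eq_zero (Finset.mem_univ l) (by simp)
  have hlift := fun l => hcov.existsUnique_continuousMap_lifts (ContinuousMap.id U) x₀
    (⟨(x₀, z l), hzroot l⟩ : E) rfl
  choose F hF using fun l => (hlift l).exists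
  have hFbase : ∀ l (y : U), ((F l y : E).1.1) = y := fun l y => congrFun (hF l).2 y
  have hFroot : ∀ l (y : U),
      (X ^ n + ∑ k : Fin n, C (a k (y : B)) * X ^ (k : ℕ)).IsRoot (F l y : E).1.2 := by
    intro l y
    have h := (F l y : E).2
    rwa [hFbase l y] at h
  -- the global roots
  let g : Fin n → B → ℂ := fun l x => if hx : x ∈ U then (F l ⟨x, hx⟩ : E).1.2 else 0
  have hg : ∀ l (y : U), g l y = (F l y : E).1.2 := fun l y => by simp [g]
  have hgroot : ∀ l, ∀ y ∈ U, (X ^ n + ∑ k : Fin n, C (a k y) * X ^ (k : ℕ)).IsRoot (g l y) := by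
    intro l y hy
    rw [show y = ((⟨y, hy⟩ : U) : B) from rfl, hg]
    exact hFroot l ⟨y, hy⟩
  -- sections through distinct points never meet
  have hginj : ∀ y ∈ U, Function.Injective fun l => g l y := by
    intro y hy l l' hll'
    have h2 : (F l ⟨y, hy⟩ : E).1.2 = (F l' ⟨y, hy⟩ : E).1.2 := by
      have := hll'
      simp only [g, dif_pos hy] at this
      exact this
    have hpt : F l ⟨y, hy⟩ = F l' ⟨y, hy⟩ := by
      apply Subtype.ext
      exact Prod.ext ((hFbase l ⟨y, hy⟩).trans (hFbase l' ⟨y, hy⟩).symm) h2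
    have huniq := (hcov.existsUnique_continuousMap_lifts (ContinuousMap.id U) ⟨y, hy⟩
      (F l ⟨y, hy⟩) (hFbase l ⟨y, hy⟩)).unique ⟨rfl, (hF l).2⟩ ⟨hpt.symm, (hF l').2⟩
    have h0 : (F l x₀ : E) = F l' x₀ := by rw [huniq]
    rw [(hF l).1, (hF l').1] at h0
    exact hz (by simpa using congrArg (fun e : E => e.1.2) h0)
  -- continuity and holomorphy of the global roots
  have hgcont : ∀ l, ContinuousOn (g l) U := by
    intro l
    rw [continuousOn_iff_continuous_restrict]
    have : (U.restrict (g l)) = fun y : U => (F l y : E).1.2 := funext fun y => hg l y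
    rw [this]
    exact hval.comp (F l).continuous
  have hgd : ∀ l, DifferentiableOn ℂ (g l) U := by
    intro l y hy
    have hyW : y ∈ W ⟨y, hy⟩ := hxW ⟨y, hy⟩
    obtain ⟨m₀, hm₀⟩ := hmem ⟨y, hy⟩ y hyW (g l y) (hgroot l y hy)
    have hev : g l =ᶠ[𝓝[U ∩ W ⟨y, hy⟩] y] r ⟨y, hy⟩ m₀ := by
      refine eventuallyEq_of_mem_range ((hgcont l y hy).mono inter_subset_left)
        (fun m => (hrc ⟨y, hy⟩ m).continuousAt ((hWo _).mem_nhds hyW)) (hrinj ⟨y, hy⟩ y hyW)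
        hm₀.symm fun x hx => ?_
      obtain ⟨m, hm⟩ := hmem ⟨y, hy⟩ x hx.2 (g l x) (hgroot l x hx.1)
      exact ⟨m, hm.symm⟩
    have hnhds : U ∩ W ⟨y, hy⟩ ∈ 𝓝 y := (hU.inter (hWo _)).mem_nhds ⟨hy, hyW⟩
    have hev' : g l =ᶠ[𝓝 y] r ⟨y, hy⟩ m₀ := by
      rwa [nhdsWithin_eq_nhds.2 hnhds] at hev
    have hdiff : DifferentiableAt ℂ (r ⟨y, hy⟩ m₀) y :=
      (hrd ⟨y, hy⟩ m₀).differentiableAt ((hWo _).mem_nhds hyW)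
    exact (hev'.differentiableAt_iff.2 hdiff).differentiableWithinAt
  refine ⟨g, hgd, fun y hy => eq_prod_of_roots a y (fun l => g l y) (hginj y hy) fun l => hgroot l y hy⟩

end Analysis

end RootCover
end Literature.Analysis.Complex

end
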